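import Literature.MathematicalPhysics.QuantumFieldTheory.Balaban1983to89.AveragingRT

/-!
# `Summit.QuantumFields.Balaban3D.Proofs.RTAlgebra` — the algebra of the renormalization transformation in the tree's push-forward
# reading (`Setup.IsRT`): additivity over the decomposition of unity (8), pull-out of functions of the average, monotonicity and
# uniqueness dV-a.e. — the [folklore] engine behind **(48)** p. 268 / **(10)** p. 258 («Thus the density ρ_{k+1} is bounded by a sum
# of terms obtained by application of the renormalization transformation T to terms on the right-hand side of (41)», p. 267 L33–35)
# in the a.e. reading of ruling R-RN — lane `pub-balaban3d`, seat p4 (ruling R-DISP: «(48) ← p1/p4 from IsRT + (8)»)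

HONEST FRAMING (lane PLAN.md §0, binding): see `…Proofs.SectAFirstStep`.  Measure theory over the tree's vocabulary
(`Setup.fieldMeasure`, `Setup.IsRT`: `∫ ρ′·f dV = ∫ ρ·(f∘Ū) dU` for bounded measurable `f`, [4] (10) p. 19 in the push-forward reading,
cell DIVERGENCE F7); nothing of [Balaban1985UV3] is asserted.  Every statement is about ARBITRARY densities `ρ` and ANY `ρ′` with
`IsRT Ū ρ ρ′` (in particular p1's Radon–Nikodym transport `Carriers.RT.rtOpIOfAC` and its R-RN re-selected version).

WHAT IS PRINTED.  p. 267 = PDF 13 L33–35: «We apply the renormalization transformation T to the density ρ_k, and we use the inductive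
inequality (41). Thus the density ρ_{k+1} is bounded by a sum of terms obtained by application of the renormalization transformation
T to terms on the right-hand side of (41).» — i.e. T is LINEAR (over the finite sum (8)/(41)) and MONOTONE; p. 258 L8–16: the terms
are transforms of `ρ₀ζ_{Ω₁ᶜ}χ_{Ω₁}` ((8) inserted, then (9)–(10)).

WHAT THIS FILE PROVES (no `sorry`, axioms standard; theorems only, LQB-only imports):
* `isRT_zero`, `IsRT.add`, `IsRT.smul`, `IsRT.sum` — T is additive / homogeneous over finite sums of integrable densities with integrable
  transforms («a sum of terms obtained by application of T to terms»);
* `IsRT.mul_comp_avg` — PULL-OUT: a bounded measurable function of the AVERAGE passes through T, `T(ρ·(g∘Ū)) = (Tρ)·g` (the mechanism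
  by which a bound on the exponent of (41)_k that depends on V_k only through V̄_k = V leaves the fibre integral, cf. ruling R-HIST′ (iii));
* `IsRT.congr_ae` — T's output is an a.e.-class: any dV-a.e. equal density is again a transform (R-RN version selection);
* `IsRT.ae_le` — MONOTONICITY dV-a.e.: `ρ₁ ≤ ρ₂` pointwise ⇒ `Tρ₁ ≤ Tρ₂` dV-a.e. (set integrals of `Tρ₂ − Tρ₁` are `∫(ρ₂ − ρ₁)·1_A(Ū) dU ≥ 0`);
* `IsRT.ae_eq` — UNIQUENESS dV-a.e. of the transform of a given ρ (twin of p1's `Carriers.RT.ae_eq_of_isRT`, kept here so that this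
  file depends on the tree only).
-/

namespace Summit.QuantumFields.Balaban3D.Proofs.RTAlgebra

open _root_.MeasureTheory
open Literature.MathematicalPhysics.QuantumFieldTheory.Balaban1983to89

variable {P : Params} {j : ℕ} {G : Type*} [GaugeGroup G] [MeasurableSpace G] [HaarData G]
  {avg : GaugeField P j G → GaugeField P (j + 1) G}

/-- A bounded measurable test function times an integrable density is integrable (fine lattice, composed with the average). [folklore] -/
theorem integrable_mul_test_comp {ρ : Density P j G} (hρ : Integrable ρ (fieldMeasure P j G)) (havg : Measurable avg)
    {f : GaugeField P (j + 1) G → ℝ} (hf : Measurable f) {C : ℝ} (hC : ∀ V, |f V| ≤ C) :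
    Integrable (fun U => ρ U * f (avg U)) (fieldMeasure P j G) :=
  hρ.mul_bdd (hf.comp havg).aestronglyMeasurable
    (Filter.Eventually.of_forall fun U => by simpa [Real.norm_eq_abs] using hC (avg U))

/-- A bounded measurable test function times an integrable density is integrable (coarse lattice). [folklore] -/
theorem integrable_mul_test {ρ' : Density P (j + 1) G} (hρ' : Integrable ρ' (fieldMeasure P (j + 1) G))
    {f : GaugeField P (j + 1) G → ℝ} (hf : Measurable f) {C : ℝ} (hC : ∀ V, |f V| ≤ C) :
    Integrable (fun V => ρ' V * f V) (fieldMeasure P (j + 1) G) :=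
  hρ'.mul_bdd hf.aestronglyMeasurable (Filter.Eventually.of_forall fun V => by simpa [Real.norm_eq_abs] using hC V)

/-- `T 0 = 0`. [folklore] -/
theorem isRT_zero : IsRT avg (fun _ => (0 : ℝ)) (fun _ => (0 : ℝ)) := by
  intro f _ _
  simp

/-- **T is additive** (p. 267 L33–35 «a sum of terms obtained by application of the renormalization transformation T to terms»):
transforms of integrable densities with integrable transforms add. [cite: Balaban1985UV3, (48) p.267] -/
theorem IsRT.add {ρ₁ ρ₂ : Density P j G} {ρ₁' ρ₂' : Density P (j + 1) G} (h₁ : IsRT avg ρ₁ ρ₁') (h₂ : IsRT avg ρ₂ ρ₂')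
    (havg : Measurable avg) (hi₁ : Integrable ρ₁ (fieldMeasure P j G)) (hi₂ : Integrable ρ₂ (fieldMeasure P j G))
    (hi₁' : Integrable ρ₁' (fieldMeasure P (j + 1) G)) (hi₂' : Integrable ρ₂' (fieldMeasure P (j + 1) G)) :
    IsRT avg (fun U => ρ₁ U + ρ₂ U) (fun V => ρ₁' V + ρ₂' V) := by
  intro f hf hfC
  obtain ⟨C, hC⟩ := hfC
  have e1 := h₁ f hf ⟨C, hC⟩
  have e2 := h₂ f hf ⟨C, hC⟩
  simp only [add_mul]
  rw [integral_add (integrable_mul_test hi₁' hf hC) (integrable_mul_test hi₂' hf hC),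
    integral_add (integrable_mul_test_comp hi₁ havg hf hC) (integrable_mul_test_comp hi₂ havg hf hC), e1, e2]

/-- **T is homogeneous**: `T(c·ρ) = c·Tρ`. [folklore] -/
theorem IsRT.smul {ρ : Density P j G} {ρ' : Density P (j + 1) G} (h : IsRT avg ρ ρ') (c : ℝ) :
    IsRT avg (fun U => c * ρ U) (fun V => c * ρ' V) := by
  intro f hf hfC
  have e := h f hf hfC
  simp only [mul_assoc]
  rw [integral_const_mul, integral_const_mul, e]

/-- **T over a finite sum** (the decomposition of unity (8) p. 258 / the history sum of (41) inserted into T, p. 267 L33–35): if every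
term `ρ_i` is integrable with an integrable transform `ρ_i′`, then `Σ_i ρ_i′` is a transform of `Σ_i ρ_i`. [cite: Balaban1985UV3, (48) p.267] -/
theorem IsRT.sum {ι : Type*} (s : Finset ι) {ρ : ι → Density P j G} {ρ' : ι → Density P (j + 1) G}
    (h : ∀ i ∈ s, IsRT avg (ρ i) (ρ' i)) (havg : Measurable avg) (hi : ∀ i ∈ s, Integrable (ρ i) (fieldMeasure P j G))
    (hi' : ∀ i ∈ s, Integrable (ρ' i) (fieldMeasure P (j + 1) G)) :
    IsRT avg (fun U => ∑ i ∈ s, ρ i U) (fun V => ∑ i ∈ s, ρ' i V) := by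
  classical
  induction s using Finset.induction_on with
  | empty => simpa using (isRT_zero (avg := avg))
  | @insert a s ha ih =>
    have hstep := IsRT.add (h a (Finset.mem_insert_self a s))
      (ih (fun i hi0 => h i (Finset.mem_insert_of_mem hi0)) (fun i hi0 => hi i (Finset.mem_insert_of_mem hi0))
        (fun i hi0 => hi' i (Finset.mem_insert_of_mem hi0)))
      havg (hi a (Finset.mem_insert_self a s)) (integrable_finsetSum _ fun i hi0 => hi i (Finset.mem_insert_of_mem hi0))
      (hi' a (Finset.mem_insert_self a s)) (integrable_finsetSum _ fun i hi0 => hi' i (Finset.mem_insert_of_mem hi0))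
    simpa [Finset.sum_insert ha] using hstep

/-- **PULL-OUT of a function of the average**: if `ρ′` is a transform of `ρ` then `ρ′·g` is a transform of `ρ·(g∘Ū)` for every bounded
measurable `g` on the coarse lattice — a weight that depends on the fine field only through its average passes through T unchanged.
(Test `IsRT` against `g·f`.) [folklore] -/
theorem IsRT.mul_comp_avg {ρ : Density P j G} {ρ' : Density P (j + 1) G} (h : IsRT avg ρ ρ')
    {g : GaugeField P (j + 1) G → ℝ} (hg : Measurable g) (hgC : ∃ C : ℝ, ∀ V, |g V| ≤ C) :
    IsRT avg (fun U => ρ U * g (avg U)) (fun V => ρ' V * g V) := by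
  intro f hf hfC
  obtain ⟨Cg, hCg⟩ := hgC
  obtain ⟨Cf, hCf⟩ := hfC
  have hgf : Measurable fun V => g V * f V := hg.mul hf
  have hbd : ∃ C : ℝ, ∀ V, |g V * f V| ≤ C := by
    refine ⟨Cg * Cf, fun V => ?_⟩
    rw [abs_mul]
    have h0 : 0 ≤ Cg := (abs_nonneg _).trans (hCg V)
    exact mul_le_mul (hCg V) (hCf V) (abs_nonneg _) h0
  have e := h (fun V => g V * f V) hgf hbd
  simp only [mul_assoc] at e ⊢
  exact e

/-- **T's output is an a.e.-class** (ruling R-RN): if `ρ′` is a transform of `ρ` and `ρ″ = ρ′` dV-a.e., then `ρ″` is a transform of `ρ`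
(all the identity sees is `∫ ρ′·f dV`). [folklore] -/
theorem IsRT.congr_ae {ρ : Density P j G} {ρ' ρ'' : Density P (j + 1) G} (h : IsRT avg ρ ρ')
    (hae : ρ'' =ᵐ[fieldMeasure P (j + 1) G] ρ') : IsRT avg ρ ρ'' := by
  intro f hf hfC
  rw [← h f hf hfC]
  exact integral_congr_ae (hae.mono fun V hV => by simp only [hV])

/-- **T is MONOTONE dV-a.e.** (the «≤» of (48) p. 268 in the a.e. reading of ruling R-RN): if `ρ₁ ≤ ρ₂` pointwise, `ρ_i′` transforms
`ρ_i`, and everything is integrable (the transforms also measurable), then `ρ₁′ ≤ ρ₂′` dV-almost everywhere — test `IsRT` against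
indicators: `∫_A (ρ₂′ − ρ₁′) dV = ∫ (ρ₂ − ρ₁)·1_A(Ū) dU ≥ 0` for every measurable `A`. [cite: Balaban1985UV3, (48) p.267] -/
theorem IsRT.ae_le {ρ₁ ρ₂ : Density P j G} {ρ₁' ρ₂' : Density P (j + 1) G} (h₁ : IsRT avg ρ₁ ρ₁') (h₂ : IsRT avg ρ₂ ρ₂')
    (hle : ∀ U, ρ₁ U ≤ ρ₂ U) (havg : Measurable avg)
    (hi₁ : Integrable ρ₁ (fieldMeasure P j G)) (hi₂ : Integrable ρ₂ (fieldMeasure P j G))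
    (hi₁' : Integrable ρ₁' (fieldMeasure P (j + 1) G)) (hi₂' : Integrable ρ₂' (fieldMeasure P (j + 1) G)) :
    ∀ᵐ V ∂(fieldMeasure P (j + 1) G), ρ₁' V ≤ ρ₂' V := by
  have hdiff : Integrable (fun V => ρ₂' V - ρ₁' V) (fieldMeasure P (j + 1) G) := hi₂'.sub hi₁'
  have key : 0 ≤ᵐ[fieldMeasure P (j + 1) G] fun V => ρ₂' V - ρ₁' V := by
    refine ae_nonneg_of_forall_setIntegral_nonneg hdiff fun A hA _ => ?_
    have hind : Measurable (A.indicator fun _ : GaugeField P (j + 1) G => (1 : ℝ)) := measurable_const.indicator hA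
    have hindC : ∃ C : ℝ, ∀ V, |A.indicator (fun _ : GaugeField P (j + 1) G => (1 : ℝ)) V| ≤ C :=
      ⟨1, fun V => by by_cases hV : V ∈ A <;> simp [hV]⟩
    have e1 := h₁ _ hind hindC
    have e2 := h₂ _ hind hindC
    have hset : ∫ V in A, (ρ₂' V - ρ₁' V) ∂(fieldMeasure P (j + 1) G)
        = ∫ V, (ρ₂' V - ρ₁' V) * A.indicator (fun _ => (1 : ℝ)) V ∂(fieldMeasure P (j + 1) G) := by
      rw [← integral_indicator hA]
      refine integral_congr_ae (Filter.Eventually.of_forall fun V => ?_)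
      by_cases hV : V ∈ A <;> simp [hV]
    rw [hset]
    obtain ⟨C, hC⟩ := hindC
    have i1 := integrable_mul_test hi₁' hind hC
    have i2 := integrable_mul_test hi₂' hind hC
    simp only [sub_mul]
    rw [integral_sub i2 i1, e1, e2, ← integral_sub (integrable_mul_test_comp hi₂ havg hind hC)
      (integrable_mul_test_comp hi₁ havg hind hC)]
    refine integral_nonneg fun U => ?_
    have hI : 0 ≤ A.indicator (fun _ : GaugeField P (j + 1) G => (1 : ℝ)) (avg U) := by
      by_cases hU : avg U ∈ A <;> simp [hU]
    have := hle U
    show (0 : ℝ) ≤ ρ₂ U * A.indicator (fun _ => (1 : ℝ)) (avg U) - ρ₁ U * A.indicator (fun _ => (1 : ℝ)) (avg U)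
    nlinarith
  exact key.mono fun V hV => by
    have hV' : (0 : ℝ) ≤ ρ₂' V - ρ₁' V := hV
    linarith

/-- **UNIQUENESS dV-a.e.** of the transform of a given `ρ` (twin of p1's `Carriers.RT.ae_eq_of_isRT`; two transforms have the same
set integrals). [folklore] -/
theorem IsRT.ae_eq {ρ : Density P j G} {ρ' ρ'' : Density P (j + 1) G} (h' : IsRT avg ρ ρ') (h'' : IsRT avg ρ ρ'')
    (havg : Measurable avg) (hi : Integrable ρ (fieldMeasure P j G))
    (hi' : Integrable ρ' (fieldMeasure P (j + 1) G)) (hi'' : Integrable ρ'' (fieldMeasure P (j + 1) G)) :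
    ρ' =ᵐ[fieldMeasure P (j + 1) G] ρ'' := by
  have h1 := IsRT.ae_le h' h'' (fun U => le_rfl) havg hi hi hi' hi''
  have h2 := IsRT.ae_le h'' h' (fun U => le_rfl) havg hi hi hi'' hi'
  filter_upwards [h1, h2] with V a b using le_antisymm a b

end Summit.QuantumFields.Balaban3D.Proofs.RTAlgebra
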